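import Literature.NumberTheory.Transcendental.CalegariDimitrovTangL2Chi3
import Literature.NumberTheory.Transcendental.PennerWeilPeterssonVolumesProofs
import Mathlib.MeasureTheory.Integral.Prod
import Mathlib.MeasureTheory.Integral.DominatedConvergence
import Mathlib.Analysis.SpecialFunctions.Integrals.Basic
import Mathlib.Analysis.SpecialFunctions.Integrability.Basic
import Mathlib.MeasureTheory.Measure.Lebesgue.Basic
import Mathlib.Tactic
import HarnessLib

/-!
# Calegari–Dimitrov–Tang, Theorem 1 — the period representations of `L(2, χ₋₃)`, proved

Sibling of `CalegariDimitrovTangL2Chi3.lean` (the named fact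
`Literature.NumberTheory.Transcendental.calegariDimitrovTang_linearIndependent`, CDT 2024
Thm. 1, and the glue constant `L2chi3 = Σ_{n ≥ 0} (1/(3n+1)² − 1/(3n+2)²)`), whose module
docstring records that "the integral representations are not formalised". Theorem 1 displays
`L(2, χ₋₃)` in three further ways (arXiv:2408.15403, p. 3):

`L(2,χ₋₃) = Σ_{n≥0} (1/(3n+1)² − 1/(3n+2)²) = 0.78130…`
`        = ∬_{1 ≥ y ≥ x ≥ 0} dx dy / (y (1 + x + x²)) = − ∫₀¹ log(x) dx / (1 + x + x²)`,

"the formula above exhibits `L(2, χ₋₃)` as a period in the sense of Kontsevich–Zagier"; and the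
overconvergence mechanism of the proof (§11.1, Remark after Prop. "functionsH", eq. (Cintegral),
p. 102) rests on the Beukers-type identity
`L(2,χ₋₃)H_A(x) − 2H_B(x) = Σₙ xⁿ ∬_{[0,1]²} (9st(1−s³)(1−t³))ⁿ ds dt/(1+st+s²t²)^{2n+1}`, whose
`n = 0` term is `∬_{[0,1]²} ds dt/(1 + st + s²t²) = L(2, χ₋₃)`. This file PROVES these
identities for the tree's `L2chi3`:

* `CalegariDimitrovTang.setIntegral_unitSquare_kernel` —
  `∫_{[0,1]²} d(s,t)/(1 + st + s²t²) = L2chi3` (Lebesgue integral on `ℝ × ℝ`), and its iterated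
  form `CalegariDimitrovTang.integral_integral_unitSquare_kernel`
  (`∫₀¹ ∫₀¹ dt ds/(1 + st + s²t²) = L2chi3`);
* `CalegariDimitrovTang.integral_integral_triangle` — **Thm. 1, second expression**:
  `∫₀¹ (∫₀^y dx/(y(1 + x + x²))) dy = L2chi3` (substitute `x = ys`);
* `CalegariDimitrovTang.neg_integral_log_div` — **Thm. 1, third expression**:
  `−∫₀¹ log(x)/(1 + x + x²) dx = L2chi3`;
* the tools: the expansion `1/(1+u+u²) = Σ_k (u^{3k} − u^{3k+1})` (`hasSum_kernel`, `0 ≤ u < 1`),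
  the moments `∫₀¹ xⁿ log x dx = −1/(n+1)²` (the tree's `integral_pow_mul_log_zero_one`,
  `PennerWeilPeterssonVolumesProofs.lean`), and the term-wise
  integrations (`setIntegral_unitSquare_term`, `setIntegral_Ioo_logTerm`), summed by absolute
  convergence (`hasSum_integral_of_summable_integral_norm`; all terms are nonnegative).

Method (a deviation from print, where these classical evaluations are quoted without proof):
expand the kernel geometrically off the null set `st = 1` (resp. on `(0,1)`), integrate
term-wise — `∬ (st)^j = 1/(j+1)²`, `∫₀¹ x^j(−log x) = 1/(j+1)²` — and recognise the defining
series of `L2chi3` (`hasSum_L2chi3`). No named facts (D-0026); nothing is conditional. Not here: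
the hypergeometric and Pascal-triangle series of p. 3, the identification with Mathlib's
`DirichletCharacter.LFunction`, and the `n ≥ 1` terms of (Cintegral).

## References

* [CalegariDimitrovTang2024] F. Calegari, V. Dimitrov, Y. Tang, *The linear independence of `1`,
  `ζ(2)`, and `L(2,χ₋₃)`*, arXiv:2408.15403 — Thm. 1 (p. 3); §11.1, Remark after
  Prop. "functionsH", eq. (Cintegral) (p. 102).
-/

noncomputable section

open MeasureTheory Set Filter Real intervalIntegral
open scoped Topology

namespace Literature.NumberTheory.Transcendental

namespace CalegariDimitrovTang

/-! ### The geometric expansion of the kernel `1/(1 + u + u²)` -/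

/-- `1 + u + u² > 0` for every real `u` (`= (u + 1/2)² + 3/4`). [folklore] -/
theorem kernel_den_pos (u : ℝ) : 0 < 1 + u + u ^ 2 := by
  nlinarith [sq_nonneg (u + 1 / 2)]

/-- **The expansion behind all three representations**: for `0 ≤ u < 1`,
`1/(1 + u + u²) = (1 − u)/(1 − u³) = Σ_{k ≥ 0} (u^{3k} − u^{3k+1})`. [folklore] -/
theorem hasSum_kernel {u : ℝ} (hu0 : 0 ≤ u) (hu1 : u < 1) :
    HasSum (fun k : ℕ => u ^ (3 * k) - u ^ (3 * k + 1)) (1 / (1 + u + u ^ 2)) := by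
  have hg := hasSum_geometric_of_lt_one (pow_nonneg hu0 3) (pow_lt_one₀ hu0 hu1 three_ne_zero)
  have h := hg.mul_left (1 - u)
  have hne : (1 : ℝ) - u ≠ 0 := by linarith
  have hf : (fun i : ℕ => (1 - u) * (u ^ 3) ^ i) = fun k => u ^ (3 * k) - u ^ (3 * k + 1) := by
    funext k
    rw [← pow_mul]
    ring
  have h3 : (1 : ℝ) - u ^ 3 = (1 - u) * (1 + u + u ^ 2) := by ring
  have hv : (1 - u) * (1 - u ^ 3)⁻¹ = 1 / (1 + u + u ^ 2) := by
    rw [h3, mul_inv, ← mul_assoc, mul_inv_cancel₀ hne, one_mul, one_div]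
  rw [hf, hv] at h
  exact h

/-! ### The unit-square integral `∬_{[0,1]²} ds dt/(1 + st + s²t²) = L(2, χ₋₃)` -/

/-- `∫_{[0,1]} xⁿ dx = 1/(n+1)` (set-integral form). [folklore] -/
theorem setIntegral_Icc_pow (n : ℕ) : ∫ x in Icc (0 : ℝ) 1, x ^ n = 1 / ((n : ℝ) + 1) := by
  rw [integral_Icc_eq_integral_Ioc, ← intervalIntegral.integral_of_le zero_le_one, integral_pow,
    one_pow, zero_pow (Nat.succ_ne_zero n), sub_zero]

/-- `∬_{[0,1]²} sⁿ tⁿ ds dt = 1/(n+1)²`. [folklore] -/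
theorem setIntegral_unitSquare_pow (n : ℕ) :
    ∫ p in Icc (0 : ℝ) 1 ×ˢ Icc (0 : ℝ) 1, p.1 ^ n * p.2 ^ n = 1 / ((n : ℝ) + 1) ^ 2 := by
  rw [Measure.volume_eq_prod, setIntegral_prod_mul (fun x : ℝ => x ^ n) (fun y : ℝ => y ^ n),
    setIntegral_Icc_pow, div_mul_div_comm, one_mul, ← sq]

/-- The unit square is compact. [folklore] -/
theorem isCompact_unitSquare : IsCompact (Icc (0 : ℝ) 1 ×ˢ Icc (0 : ℝ) 1) :=
  isCompact_Icc.prod isCompact_Icc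

/-- The unit square is measurable. [folklore] -/
theorem measurableSet_unitSquare : MeasurableSet (Icc (0 : ℝ) 1 ×ˢ Icc (0 : ℝ) 1) :=
  measurableSet_Icc.prod measurableSet_Icc

/-- The `k`-th term `(st)^{3k} − (st)^{3k+1}` of the expanded kernel is integrable on the unit
square (continuous on a compact set). [folklore] -/
theorem integrableOn_unitSquare_term (k : ℕ) :
    IntegrableOn (fun p : ℝ × ℝ => (p.1 * p.2) ^ (3 * k) - (p.1 * p.2) ^ (3 * k + 1))
      (Icc (0 : ℝ) 1 ×ˢ Icc (0 : ℝ) 1) volume :=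
  ContinuousOn.integrableOn_compact isCompact_unitSquare (Continuous.continuousOn (by fun_prop))

/-- **Term-wise integrals**: `∬_{[0,1]²} ((st)^{3k} − (st)^{3k+1}) ds dt = 1/(3k+1)² − 1/(3k+2)²`,
the `k`-th term of CDT's series for `L(2, χ₋₃)`. [folklore] -/
theorem setIntegral_unitSquare_term (k : ℕ) :
    ∫ p in Icc (0 : ℝ) 1 ×ˢ Icc (0 : ℝ) 1, ((p.1 * p.2) ^ (3 * k) - (p.1 * p.2) ^ (3 * k + 1))
      = 1 / (3 * (k : ℝ) + 1) ^ 2 - 1 / (3 * (k : ℝ) + 2) ^ 2 := by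
  have hint : ∀ n : ℕ, IntegrableOn (fun p : ℝ × ℝ => p.1 ^ n * p.2 ^ n)
      (Icc (0 : ℝ) 1 ×ˢ Icc (0 : ℝ) 1) volume := fun n =>
    ContinuousOn.integrableOn_compact isCompact_unitSquare (Continuous.continuousOn (by fun_prop))
  simp_rw [mul_pow]
  rw [integral_sub (hint _) (hint _), setIntegral_unitSquare_pow, setIntegral_unitSquare_pow]
  push_cast
  ring

/-- On the unit square the terms are nonnegative: `(st)^{3k} − (st)^{3k+1} = (st)^{3k}(1 − st) ≥ 0`.
[folklore] -/
theorem term_nonneg {p : ℝ × ℝ} (hp : p ∈ Icc (0 : ℝ) 1 ×ˢ Icc (0 : ℝ) 1) (k : ℕ) :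
    0 ≤ (p.1 * p.2) ^ (3 * k) - (p.1 * p.2) ^ (3 * k + 1) := by
  obtain ⟨⟨h10, h11⟩, ⟨h20, h21⟩⟩ := hp
  have hu0 : 0 ≤ p.1 * p.2 := mul_nonneg h10 h20
  have hu1 : p.1 * p.2 ≤ 1 := mul_le_one₀ h11 h20 h21
  rw [pow_succ]
  nlinarith [pow_nonneg hu0 (3 * k)]

/-- **Summing the term-wise integrals** (dominated/absolute convergence,
`hasSum_integral_of_summable_integral_norm`): the integrals of the terms over the unit square
sum to the integral of the summed kernel. [folklore] -/
theorem hasSum_setIntegral_unitSquare_terms :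
    HasSum (fun k : ℕ => 1 / (3 * (k : ℝ) + 1) ^ 2 - 1 / (3 * (k : ℝ) + 2) ^ 2)
      (∫ p in Icc (0 : ℝ) 1 ×ˢ Icc (0 : ℝ) 1,
        ∑' k : ℕ, ((p.1 * p.2) ^ (3 * k) - (p.1 * p.2) ^ (3 * k + 1))) := by
  have hnorm : ∀ k : ℕ, ∫ p in Icc (0 : ℝ) 1 ×ˢ Icc (0 : ℝ) 1,
      ‖(p.1 * p.2) ^ (3 * k) - (p.1 * p.2) ^ (3 * k + 1)‖
        = 1 / (3 * (k : ℝ) + 1) ^ 2 - 1 / (3 * (k : ℝ) + 2) ^ 2 := by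
    intro k
    rw [← setIntegral_unitSquare_term k]
    exact setIntegral_congr_fun measurableSet_unitSquare fun p hp =>
      Real.norm_of_nonneg (term_nonneg hp k)
  have hsum : Summable fun k : ℕ => ∫ p in Icc (0 : ℝ) 1 ×ˢ Icc (0 : ℝ) 1,
      ‖(p.1 * p.2) ^ (3 * k) - (p.1 * p.2) ^ (3 * k + 1)‖ := by
    refine summable_L2chi3_series.congr fun k => ?_
    rw [hnorm k]
  have h := hasSum_integral_of_summable_integral_norm
    (μ := volume.restrict (Icc (0 : ℝ) 1 ×ˢ Icc (0 : ℝ) 1))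
    (F := fun (k : ℕ) (p : ℝ × ℝ) => (p.1 * p.2) ^ (3 * k) - (p.1 * p.2) ^ (3 * k + 1))
    integrableOn_unitSquare_term hsum
  have hfun : (fun k : ℕ => 1 / (3 * (k : ℝ) + 1) ^ 2 - 1 / (3 * (k : ℝ) + 2) ^ 2)
      = fun k : ℕ => ∫ p in Icc (0 : ℝ) 1 ×ˢ Icc (0 : ℝ) 1,
          ((p.1 * p.2) ^ (3 * k) - (p.1 * p.2) ^ (3 * k + 1)) :=
    funext fun k => (setIntegral_unitSquare_term k).symm
  rw [hfun]
  exact h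

/-- Hence `∬_{[0,1]²} Σ_k ((st)^{3k} − (st)^{3k+1}) ds dt = L(2, χ₋₃)` (uniqueness of sums, with
`hasSum_L2chi3`). [folklore] -/
theorem setIntegral_unitSquare_tsum :
    ∫ p in Icc (0 : ℝ) 1 ×ˢ Icc (0 : ℝ) 1,
        ∑' k : ℕ, ((p.1 * p.2) ^ (3 * k) - (p.1 * p.2) ^ (3 * k + 1)) = L2chi3 :=
  hasSum_setIntegral_unitSquare_terms.unique hasSum_L2chi3

/-- The half-open unit square agrees with the closed one up to a Lebesgue-null set. [folklore] -/
theorem Ico_prod_Ico_ae_eq_unitSquare :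
    (Ico (0 : ℝ) 1 ×ˢ Ico (0 : ℝ) 1 : Set (ℝ × ℝ)) =ᵐ[volume] (Icc (0 : ℝ) 1 ×ˢ Icc (0 : ℝ) 1) := by
  rw [Measure.volume_eq_prod]
  exact Measure.set_prod_ae_eq Ico_ae_eq_Icc Ico_ae_eq_Icc

/-- **`L(2, χ₋₃)` as a period over the unit square**:
`∬_{[0,1]²} ds dt / (1 + st + s²t²) = L(2, χ₋₃)`. This is the `n = 0` term of CDT's
Beukers-type identity (Cintegral) `L(2,χ₋₃)H_A(x) − 2H_B(x) = Σₙ xⁿ ∬_{[0,1]²} …` (§11.1,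
Remark after Prop. "functionsH", p. 102), and, after `x = ys`, the double integral displayed in
Theorem 1. Proof: expand the kernel (`hasSum_kernel`, valid off the null corner `st = 1`) and
integrate term-wise. [cite: CalegariDimitrovTang2024, Thm. 1 (p. 3) and §11.1 eq. (Cintegral) (p. 102)] -/
theorem setIntegral_unitSquare_kernel :
    ∫ p in Icc (0 : ℝ) 1 ×ˢ Icc (0 : ℝ) 1, 1 / (1 + p.1 * p.2 + p.1 ^ 2 * p.2 ^ 2) = L2chi3 := by
  rw [← setIntegral_unitSquare_tsum, ← setIntegral_congr_set Ico_prod_Ico_ae_eq_unitSquare,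
    ← setIntegral_congr_set Ico_prod_Ico_ae_eq_unitSquare]
  refine setIntegral_congr_fun (measurableSet_Ico.prod measurableSet_Ico) fun p hp => ?_
  obtain ⟨⟨h10, h11⟩, ⟨h20, h21⟩⟩ := hp
  have hu1 : p.1 * p.2 < 1 := mul_lt_one_of_nonneg_of_lt_one_left h10 h11 h21.le
  rw [← mul_pow]
  exact ((hasSum_kernel (mul_nonneg h10 h20) hu1).tsum_eq).symm

/-- **Iterated form**: `∫₀¹ ∫₀¹ dt ds / (1 + st + s²t²) = L(2, χ₋₃)` (Fubini on the unit square;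
the kernel is continuous, `1 + u + u² ≥ 3/4`). [cite: CalegariDimitrovTang2024, Thm. 1 (p. 3) and §11.1 eq. (Cintegral) (p. 102)] -/
theorem integral_integral_unitSquare_kernel :
    ∫ s in (0 : ℝ)..1, ∫ t in (0 : ℝ)..1, 1 / (1 + s * t + s ^ 2 * t ^ 2) = L2chi3 := by
  have hcont : Continuous fun p : ℝ × ℝ => 1 / (1 + p.1 * p.2 + p.1 ^ 2 * p.2 ^ 2) := by
    refine Continuous.div continuous_const (by fun_prop) fun p => ?_
    have := kernel_den_pos (p.1 * p.2)
    rw [mul_pow] at this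
    exact this.ne'
  have hint : IntegrableOn (fun p : ℝ × ℝ => 1 / (1 + p.1 * p.2 + p.1 ^ 2 * p.2 ^ 2))
      (Icc (0 : ℝ) 1 ×ˢ Icc (0 : ℝ) 1) ((volume : Measure ℝ).prod volume) := by
    rw [← Measure.volume_eq_prod]
    exact ContinuousOn.integrableOn_compact isCompact_unitSquare hcont.continuousOn
  have h := setIntegral_prod _ hint
  rw [← Measure.volume_eq_prod, setIntegral_unitSquare_kernel] at h
  -- `h : L2chi3 = ∫ s in Icc 0 1, ∫ t in Icc 0 1, …`
  rw [h, intervalIntegral.integral_of_le zero_le_one, integral_Icc_eq_integral_Ioc]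
  refine setIntegral_congr_fun measurableSet_Ioc fun s _ => ?_
  rw [intervalIntegral.integral_of_le zero_le_one, integral_Icc_eq_integral_Ioc]

/-! ### The double integral of Theorem 1: `∬_{1 ≥ y ≥ x ≥ 0} dx dy / (y(1 + x + x²))` -/

/-- **Theorem 1, second expression**: `L(2, χ₋₃) = ∬_{1 ≥ y ≥ x ≥ 0} dx dy / (y (1 + x + x²))`,
read as the iterated integral `∫₀¹ (∫₀^y dx / (y(1 + x + x²))) dy` (the inner integral is a
proper Riemann integral for every `y > 0`; the single value `y = 0` is immaterial). Proof: the
substitution `x = ys` turns the inner integral into `∫₀¹ ds/(1 + ys + y²s²)`, and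
`integral_integral_unitSquare_kernel`. "The formula above exhibits `L(2, χ₋₃)` as a period in the
sense of Kontsevich–Zagier." [cite: CalegariDimitrovTang2024, Thm. 1 (p. 3)] -/
theorem integral_integral_triangle :
    ∫ y in (0 : ℝ)..1, ∫ x in (0 : ℝ)..y, 1 / (y * (1 + x + x ^ 2)) = L2chi3 := by
  rw [← integral_integral_unitSquare_kernel]
  refine intervalIntegral.integral_congr_ae (ae_of_all _ fun y hy => ?_)
  rw [Set.uIoc_of_le zero_le_one] at hy
  have hy0 : 0 < y := hy.1
  have e1 : (fun x : ℝ => 1 / (y * (1 + x + x ^ 2))) = fun x => y⁻¹ * (1 / (1 + x + x ^ 2)) := by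
    funext x
    rw [mul_comm y, ← div_div, div_eq_mul_inv _ y, mul_comm]
  have e2 := intervalIntegral.integral_comp_mul_left (a := 0) (b := 1)
    (fun x : ℝ => 1 / (1 + x + x ^ 2)) hy0.ne'
  rw [mul_zero, mul_one, smul_eq_mul, ← intervalIntegral.integral_const_mul] at e2
  rw [e1, ← e2]
  refine intervalIntegral.integral_congr fun t _ => ?_
  simp only [mul_pow]

/-! ### The logarithmic integral of Theorem 1: `−∫₀¹ log(x) dx / (1 + x + x²)` -/

/-! The moments `∫₀¹ xⁿ log x dx = −1/(n+1)²` are already in the tree: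
`Literature.NumberTheory.Transcendental.integral_pow_mul_log_zero_one`
(`PennerWeilPeterssonVolumesProofs.lean`), reused here. -/

/-- The moment integrands `xᵐ log x` are integrable on `(0, 1)`. [folklore] -/
theorem integrableOn_pow_mul_log (m : ℕ) :
    IntegrableOn (fun x : ℝ => x ^ m * Real.log x) (Ioo (0 : ℝ) 1) volume := by
  have h := (intervalIntegrable_log' (a := (0 : ℝ)) (b := 1)).continuousOn_mul
    (Continuous.continuousOn (continuous_pow m))
  rw [intervalIntegrable_iff, Set.uIoc_of_le zero_le_one] at h
  exact h.mono_set Ioo_subset_Ioc_self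

/-- **Term-wise logarithmic integrals**:
`∫₀¹ (x^{3k+1} − x^{3k}) log x dx = 1/(3k+1)² − 1/(3k+2)²`. [folklore] -/
theorem setIntegral_Ioo_logTerm (k : ℕ) :
    ∫ x in Ioo (0 : ℝ) 1, (x ^ (3 * k + 1) * Real.log x - x ^ (3 * k) * Real.log x)
      = 1 / (3 * (k : ℝ) + 1) ^ 2 - 1 / (3 * (k : ℝ) + 2) ^ 2 := by
  rw [integral_sub (integrableOn_pow_mul_log _) (integrableOn_pow_mul_log _),
    ← integral_Ioc_eq_integral_Ioo, ← integral_Ioc_eq_integral_Ioo,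
    ← intervalIntegral.integral_of_le zero_le_one, ← intervalIntegral.integral_of_le zero_le_one,
    integral_pow_mul_log_zero_one, integral_pow_mul_log_zero_one]
  push_cast
  ring

/-- On `(0,1)` the logarithmic terms are nonnegative: `(x^{3k+1} − x^{3k}) log x =
x^{3k}(1 − x)(−log x) ≥ 0`. [folklore] -/
theorem logTerm_nonneg {x : ℝ} (hx : x ∈ Ioo (0 : ℝ) 1) (k : ℕ) :
    0 ≤ x ^ (3 * k + 1) * Real.log x - x ^ (3 * k) * Real.log x := by
  have hlog : Real.log x ≤ 0 := Real.log_nonpos hx.1.le hx.2.le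
  have hxk : 0 ≤ x ^ (3 * k) := pow_nonneg hx.1.le _
  have h1x : 0 ≤ 1 - x := by linarith [hx.2]
  have : x ^ (3 * k + 1) * Real.log x - x ^ (3 * k) * Real.log x
      = x ^ (3 * k) * (1 - x) * (-Real.log x) := by
    rw [pow_succ]
    ring
  rw [this]
  exact mul_nonneg (mul_nonneg hxk h1x) (by linarith)

/-- **Summing the logarithmic terms**: the term integrals sum to
`∫_{(0,1)} Σ_k (x^{3k+1} − x^{3k}) log x dx`. [folklore] -/
theorem hasSum_setIntegral_Ioo_logTerms :
    HasSum (fun k : ℕ => 1 / (3 * (k : ℝ) + 1) ^ 2 - 1 / (3 * (k : ℝ) + 2) ^ 2)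
      (∫ x in Ioo (0 : ℝ) 1,
        ∑' k : ℕ, (x ^ (3 * k + 1) * Real.log x - x ^ (3 * k) * Real.log x)) := by
  have hnorm : ∀ k : ℕ, ∫ x in Ioo (0 : ℝ) 1, ‖x ^ (3 * k + 1) * Real.log x - x ^ (3 * k) * Real.log x‖
      = 1 / (3 * (k : ℝ) + 1) ^ 2 - 1 / (3 * (k : ℝ) + 2) ^ 2 := by
    intro k
    rw [← setIntegral_Ioo_logTerm k]
    exact setIntegral_congr_fun measurableSet_Ioo fun x hx =>
      Real.norm_of_nonneg (logTerm_nonneg hx k)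
  have hsum : Summable fun k : ℕ => ∫ x in Ioo (0 : ℝ) 1,
      ‖x ^ (3 * k + 1) * Real.log x - x ^ (3 * k) * Real.log x‖ := by
    refine summable_L2chi3_series.congr fun k => ?_
    rw [hnorm k]
  have h := hasSum_integral_of_summable_integral_norm
    (μ := volume.restrict (Ioo (0 : ℝ) 1))
    (F := fun (k : ℕ) (x : ℝ) => x ^ (3 * k + 1) * Real.log x - x ^ (3 * k) * Real.log x)
    (fun k => (integrableOn_pow_mul_log _).sub (integrableOn_pow_mul_log _)) hsum
  have hfun : (fun k : ℕ => 1 / (3 * (k : ℝ) + 1) ^ 2 - 1 / (3 * (k : ℝ) + 2) ^ 2)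
      = fun k : ℕ => ∫ x in Ioo (0 : ℝ) 1,
          (x ^ (3 * k + 1) * Real.log x - x ^ (3 * k) * Real.log x) :=
    funext fun k => (setIntegral_Ioo_logTerm k).symm
  rw [hfun]
  exact h

/-- **Theorem 1, third expression**: `L(2, χ₋₃) = −∫₀¹ log(x) dx / (1 + x + x²)` (an
absolutely convergent improper integral: `log` is integrable at `0`). Proof: on `(0,1)`,
`−log x/(1 + x + x²) = Σ_k (x^{3k+1} − x^{3k}) log x` (`hasSum_kernel`), and the nonnegative terms
integrate to `1/(3k+1)² − 1/(3k+2)²` (`integral_pow_mul_log_zero_one`).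
[cite: CalegariDimitrovTang2024, Thm. 1 (p. 3)] -/
theorem neg_integral_log_div :
    -∫ x in (0 : ℝ)..1, Real.log x / (1 + x + x ^ 2) = L2chi3 := by
  rw [← intervalIntegral.integral_neg, intervalIntegral.integral_of_le zero_le_one,
    integral_Ioc_eq_integral_Ioo,
    ← hasSum_setIntegral_Ioo_logTerms.unique hasSum_L2chi3]
  refine setIntegral_congr_fun measurableSet_Ioo fun x hx => ?_
  have h := (hasSum_kernel hx.1.le hx.2).mul_right (-Real.log x)
  have hf : (fun k : ℕ => (x ^ (3 * k) - x ^ (3 * k + 1)) * -Real.log x)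
      = fun k : ℕ => x ^ (3 * k + 1) * Real.log x - x ^ (3 * k) * Real.log x := by
    funext k
    ring
  have hv : 1 / (1 + x + x ^ 2) * -Real.log x = -(Real.log x / (1 + x + x ^ 2)) := by
    ring
  rw [hf, hv] at h
  exact h.tsum_eq.symm

end CalegariDimitrovTang

end Literature.NumberTheory.Transcendental
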